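import Literature.Probability.Percolation.PlateCrossingEvents
import Literature.Probability.Percolation.CardyFormulaConformalInvariance
import Literature.Probability.Percolation.QuadCrossingSquareModel
import Literature.Probability.Percolation.FullPlaneCNL
import Literature.Probability.Percolation.TriAnnulusCrossingProofs
import Literature.Probability.Percolation.TriAnnulusArms
import Literature.Probability.Percolation.BrickHex
import Literature.Probability.Percolation.CommonOneArmWindow
import Literature.Probability.Percolation.SiteConnectionTools
import Literature.Probability.Percolation.TriHexLemma
import Literature.Probability.LatticeModels.TriangularLatticeProofs
import Literature.Probability.RandomPlanarGeometry.ConformalRectangleProofs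
import HarnessLib

/-!
# Polarisation of plate-crossing probabilities for critical site percolation on `𝕋`

Topic `Literature/Probability/Percolation`; proofs only.  For the plate events of
`PlateCrossingEvents.lean` in the coordinates of a square model `Φ` of a conformal rectangle `Q`
(`IsSquareModel Q Φ`), **planar duality with room on `𝕋`** (hypothesis `hG2`, stub G2 of the
`oracle-sandwich` line) and **a horizontal plate crossing spanning `Q` blocks the G02 crossings of
`Q` of the other colour** (hypothesis `hB`, part of stub B) imply

`2 · tri(Q, δ) ≤ P(MV_T(P₃)) + 1 - P(MH_T(P₄))` eventually as `δ → 0⁺`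

(`polarT_of`; `tri(Q, δ) = triDomainCrossingProb Q δ`, `P = triSitePercolation ½`,
`MV_T`/`MH_T` the monochromatic vertical/horizontal plate crossings of the plates
`(1+11κ/20, 1-11κ/20, 1+11κ/20)` / `(1+3κ/10, 1+11κ/20, 1-3κ/10)`).  Ingredients: colour-flip
symmetry of `triSitePercolation ½`, measurability of plate events (finitely many sites in the
window), inclusions of plate events.  This is the `𝕋` half of the mono-polarisation engine of the
transfer "loop-ensemble closeness ⇒ crossing probabilities close" (Camia–Newman 2006, §5–6).

## References

* F. Camia, C. M. Newman, Comm. Math. Phys. 268 (2006), §5–6 [CamiaNewman2006].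
* B. Bollobás, O. Riordan, *Percolation*, CUP 2006, Ch. 7 [BollobasRiordan2006].
-/

noncomputable section

namespace Literature.Probability.Percolation

open Literature.Probability.RandomPlanarGeometry hiding cardyFunction
open Literature.Probability.LatticeModels
open Filter _root_.Topology Set _root_.MeasureTheory Metric Complex

/-- A plate site set of `𝕋` is finite (`δ > 0`, plate inside `plateBox 2 2`). [folklore] -/
theorem finite_triPlateSites {Φ : ℂ ≃ₜ ℂ} {W₀ : ℝ} (hW : Φ '' plateBox 2 2 ⊆ closedBall (0 : ℂ) W₀)
    {δ : ℝ} (hδ : 0 < δ) {S : Set ℂ} (hS : S ⊆ plateBox 2 2) :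
    {w : Site 2 | triMeshPoint δ w ∈ Φ '' S}.Finite := by
  refine (finite_setOf_dist_triMeshPoint_le hδ 0 W₀).subset fun w hw => ?_
  exact mem_closedBall.1 (hW (image_mono hS hw))

/-- Plate crossing events of `𝕋` are measurable. [folklore] -/
theorem measurableSet_triPlate {Φ : ℂ ≃ₜ ℂ} {W₀ : ℝ} (hW : Φ '' plateBox 2 2 ⊆ closedBall (0 : ℂ) W₀)
    {δ : ℝ} (hδ : 0 < δ) {S : Set ℂ} (hS : S ⊆ plateBox 2 2) (A B : Set (Site 2)) :
    MeasurableSet {ω : SiteConfig (Site 2) | ∃ u ∈ A, ∃ v ∈ B,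
      ω ∈ siteConnIn triGraph {w | triMeshPoint δ w ∈ Φ '' S} u v} := by
  have hfin := finite_triPlateSites hW hδ hS
  have heq : {ω : SiteConfig (Site 2) | ∃ u ∈ A, ∃ v ∈ B,
      ω ∈ siteConnIn triGraph {w | triMeshPoint δ w ∈ Φ '' S} u v} =
      ⋃ u ∈ A, ⋃ v ∈ B, siteConnIn triGraph (↑hfin.toFinset) u v := by
    ext ω
    simp only [mem_setOf_eq, mem_iUnion, exists_prop, Finite.coe_toFinset]
  rw [heq]
  exact MeasurableSet.biUnion (to_countable _) fun u _ =>
    MeasurableSet.biUnion (to_countable _) fun v _ => measurableSet_siteConnIn _ _ u v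

/-- The G02 crossing event of `𝕋` is measurable (`δ > 0`). [folklore] -/
theorem measurableSet_triCrossing' (R : ConformalRectangle) {δ : ℝ} (hδ : 0 < δ) :
    MeasurableSet (triCrossing R.carrier δ (R.arc 0) (R.arc 2)) := by
  have hfin : (triMeshDomain R.carrier δ).Finite := triMeshDomain_finite_holds R.isBounded hδ
  have heq : triCrossing R.carrier δ (R.arc 0) (R.arc 2) =
      ⋃ x ∈ triDiscreteArc R.carrier δ (R.arc 0), ⋃ y ∈ triDiscreteArc R.carrier δ (R.arc 2),
        siteConnIn (triDiscreteDomainGraph R.carrier δ) (↑hfin.toFinset) x y := by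
    ext ω
    simp only [triCrossing, mem_setOf_eq, mem_iUnion, exists_prop, Finite.coe_toFinset]
  rw [heq]
  exact MeasurableSet.biUnion (to_countable _) fun x _ ↦
    MeasurableSet.biUnion (to_countable _) fun y _ ↦ measurableSet_siteConnIn _ _ x y

/-- S2 from G2 (𝕋 plate duality) + B2' (plate crossings block G02 crossings) + colour flip.
[folklore] -/
theorem polarT_of
    (hG2 : ∀ (Φ : ℂ ≃ₜ ℂ) (ν : ℝ), 0 < ν → ∃ δ₀ : ℝ, 0 < δ₀ ∧ ∀ δ : ℝ, 0 < δ → δ ≤ δ₀ →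
      ∀ ω : SiteConfig (Site 2),
        (∀ x yin yout : ℝ, 2 * ν < x → x ≤ 2 → 0 < yin → yin + 2 * ν ≤ yout → yout ≤ 2 →
          (ω ∉ triPlateV Φ δ x yin yout → ωᶜ ∈ triPlateH Φ δ (x - 2 * ν) x (yin + 2 * ν)) ∧
          (ωᶜ ∉ triPlateV Φ δ x yin yout → ω ∈ triPlateH Φ δ (x - 2 * ν) x (yin + 2 * ν))) ∧
        (∀ xin xout y : ℝ, 2 * ν < y → y ≤ 2 → 0 < xin → xin + 2 * ν ≤ xout → xout ≤ 2 →
          (ω ∉ triPlateH Φ δ xin xout y → ωᶜ ∈ triPlateV Φ δ (xin + 2 * ν) (y - 2 * ν) y) ∧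
          (ωᶜ ∉ triPlateH Φ δ xin xout y → ω ∈ triPlateV Φ δ (xin + 2 * ν) (y - 2 * ν) y)))
    (hB : ∀ (Q : ConformalRectangle) (Φ : ℂ ≃ₜ ℂ), IsSquareModel Q Φ → ∀ ν : ℝ, 0 < ν →
      ∃ δ₀ : ℝ, 0 < δ₀ ∧ ∀ δ : ℝ, 0 < δ → δ ≤ δ₀ →
        ∀ (xin xout y : ℝ), 1 + ν ≤ xin → xin ≤ xout → xout ≤ 2 → 0 < y → y + ν ≤ 1 →
          ∀ ω : SiteConfig (Site 2),
            (ω ∈ triPlateH Φ δ xin xout y → ωᶜ ∈ triCrossing Q.carrier δ (Q.arc 0) (Q.arc 2) → False) ∧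
            (ωᶜ ∈ triPlateH Φ δ xin xout y → ω ∈ triCrossing Q.carrier δ (Q.arc 0) (Q.arc 2) → False)) :
  ∀ (Q : ConformalRectangle) (Φ : ℂ ≃ₜ ℂ), IsSquareModel Q Φ → ∀ κ : ℝ, 0 < κ → κ ≤ 1 / 2 →
    ∀ᶠ δ : ℝ in 𝓝[>] 0,
      2 * triDomainCrossingProb Q δ ≤
        (triSitePercolation half).real (triMonoPlateV Φ δ (1 + 11 * κ / 20) (1 - 11 * κ / 20) (1 + 11 * κ / 20)) + 1 -
          (triSitePercolation half).real (triMonoPlateH Φ δ (1 + 3 * κ / 10) (1 + 11 * κ / 20) (1 - 3 * κ / 10)) := by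
  intro Q Φ hΦ κ hκ hκ1
  have hν : 0 < κ / 10 := by positivity
  obtain ⟨δ₁, hδ₁, hdual⟩ := hG2 Φ (κ / 10) hν
  obtain ⟨δ₂, hδ₂, hblock⟩ := hB Q Φ hΦ (κ / 10) hν
  obtain ⟨W₀, hW₀, hW⟩ := exists_closedBall_superset_plateBox Φ
  have hev : ∀ᶠ δ : ℝ in 𝓝[>] 0, δ ∈ Ioo 0 (min δ₁ δ₂) := Ioo_mem_nhdsGT (lt_min hδ₁ hδ₂)
  filter_upwards [hev] with δ hδ
  have hδpos : 0 < δ := hδ.1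
  have hδ₁' : δ ≤ δ₁ := (hδ.2.trans_le (min_le_left _ _)).le
  have hδ₂' : δ ≤ δ₂ := (hδ.2.trans_le (min_le_right _ _)).le
  -- events
  set Ho : Set (SiteConfig (Site 2)) := triPlateH Φ δ (1 + 3 * κ / 10) (1 + 11 * κ / 20) (1 - 3 * κ / 10) with hHo
  set Hc : Set (SiteConfig (Site 2)) := compl ⁻¹' Ho with hHc
  set G : Set (SiteConfig (Site 2)) := triCrossing Q.carrier δ (Q.arc 0) (Q.arc 2) with hG
  set Gc : Set (SiteConfig (Site 2)) := compl ⁻¹' G with hGc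
  set M3 : Set (SiteConfig (Site 2)) := triMonoPlateV Φ δ (1 + 11 * κ / 20) (1 - 11 * κ / 20) (1 + 11 * κ / 20) with hM3
  set M4 : Set (SiteConfig (Site 2)) := triMonoPlateV Φ δ (1 + κ / 2) (1 - κ / 2) (1 + κ / 2) with hM4
  -- measurability
  have hbox₁ : plateBox (1 + 11 * κ / 20) (1 - 3 * κ / 10) ⊆ plateBox 2 2 := fun z hz =>
    ⟨⟨by linarith [hz.1.1], by linarith [hz.1.2]⟩, ⟨by linarith [hz.2.1], by linarith [hz.2.2]⟩⟩
  have hHom : MeasurableSet Ho := measurableSet_triPlate hW hδpos hbox₁ _ _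
  have hcm : Measurable (compl : SiteConfig (Site 2) → SiteConfig (Site 2)) :=
    measurable_set_iff.2 fun i => (measurable_set_mem i).not
  have hHcm : MeasurableSet Hc := hcm hHom
  have hGm : MeasurableSet G := measurableSet_triCrossing' Q hδpos
  -- (ii) blocking: Ho misses Gc, Hc misses G
  have hbl := hblock δ hδpos hδ₂' (1 + 3 * κ / 10) (1 + 11 * κ / 20) (1 - 3 * κ / 10)
    (by linarith) (by linarith) (by linarith) (by linarith) (by linarith)
  have h2a : Ho ⊆ Gcᶜ := fun ω hω hω' => (hbl ω).1 hω hω'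
  have h2b : Hc ⊆ Gᶜ := fun ω hω hω' => (hbl ω).2 hω hω'
  -- (iii) duality: off M4, both Ho and Hc
  have h3 : M4ᶜ ⊆ Ho ∩ Hc := by
    intro ω hω
    simp only [hM4, triMonoPlateV, mem_compl_iff, mem_union, mem_preimage, not_or] at hω
    have hd := (hdual δ hδpos hδ₁' ω).1 (1 + κ / 2) (1 - κ / 2) (1 + κ / 2)
      (by linarith) (by linarith) (by linarith) (by linarith) (by linarith)
    have e1 : (1 + κ / 2) - 2 * (κ / 10) = 1 + 3 * κ / 10 := by ring
    have e2 : (1 - κ / 2) + 2 * (κ / 10) = 1 - 3 * κ / 10 := by ring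
    constructor
    · -- no closed vertical ⇒ open horizontal
      have h := hd.2 hω.2
      rw [e1, e2] at h
      exact triPlateH_mono Φ δ le_rfl (by linarith) le_rfl h
    · have h := hd.1 hω.1
      rw [e1, e2] at h
      exact triPlateH_mono Φ δ le_rfl (by linarith) le_rfl h
  -- (iv) M4 ⊆ M3
  have h4 : M4 ⊆ M3 := by
    refine union_subset_union (triPlateV_mono Φ δ (by linarith) (by linarith) (by linarith)) ?_
    exact preimage_mono (triPlateV_mono Φ δ (by linarith) (by linarith) (by linarith))
  -- probabilities
  have hGc : (triSitePercolation half).real Gc = (triSitePercolation half).real G := triSitePercolation_half_real_preimage_compl G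
  have hHc : (triSitePercolation half).real Hc = (triSitePercolation half).real Ho := triSitePercolation_half_real_preimage_compl Ho
  have htri : triDomainCrossingProb Q δ = (triSitePercolation half).real G := triDomainCrossingProb_eq_measureReal Q δ
  have hHo_le : (triSitePercolation half).real Ho ≤ 1 - (triSitePercolation half).real G := by
    have := measureReal_mono (μ := (triSitePercolation half)) h2a
    rw [measureReal_compl (hcm hGm), probReal_univ, hGc] at this
    exact this
  have hHc_le : (triSitePercolation half).real Hc ≤ 1 - (triSitePercolation half).real G := by
    have := measureReal_mono (μ := (triSitePercolation half)) h2b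
    rw [measureReal_compl hGm, probReal_univ] at this
    exact this
  have hunion : (triSitePercolation half).real (Ho ∪ Hc) + (triSitePercolation half).real (Ho ∩ Hc) = (triSitePercolation half).real Ho + (triSitePercolation half).real Hc :=
    measureReal_union_add_inter hHcm
  have hinter : 1 - (triSitePercolation half).real M3 ≤ (triSitePercolation half).real (Ho ∩ Hc) := by
    have h1 : (triSitePercolation half).real M4ᶜ ≤ (triSitePercolation half).real (Ho ∩ Hc) := measureReal_mono h3
    have h2 : (triSitePercolation half).real M4 ≤ (triSitePercolation half).real M3 := measureReal_mono h4
    have h3' : 1 - (triSitePercolation half).real M4 ≤ (triSitePercolation half).real M4ᶜ := by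
      have hle : (triSitePercolation half).real (univ : Set (SiteConfig (Site 2))) ≤ (triSitePercolation half).real M4 + (triSitePercolation half).real M4ᶜ := by
        rw [← union_compl_self M4]
        exact measureReal_union_le _ _
      rw [probReal_univ] at hle
      linarith
    linarith
  have hMH : (triSitePercolation half).real (triMonoPlateH Φ δ (1 + 3 * κ / 10) (1 + 11 * κ / 20) (1 - 3 * κ / 10)) = (triSitePercolation half).real (Ho ∪ Hc) := rfl
  rw [hMH, htri]
  linarith

end Literature.Probability.Percolation

end
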